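import Mathlib
import Summits.Ventures.HodgeRepro2.LevelPositivity
import Summits.Ventures.HodgeRepro2.T5LevelIdempotentNaturality

/-!
# The Hecke algebra `H(G, K)` without Haar measure: `End_G(k[G ⧸ K])` acting on `V^K`

Blind cell `pub-hodge-repro2`, seat p8 (gen 8), Tier-5 kernel support.  The Hecke dictionary of
the N3 chain (route/T5-CHECK-N3-p8.md §12.2, rows 3–5) keeps «`H(G)` itself» and «`R = H(G)`» as
prose: the convolution algebra of locally constant compactly supported functions needs a Haar
measure.  This file records the Haar-free form of the same objects, for an abstract group `G`, a
subgroup `K` and a representation `ρ : Representation k G V`: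

* `equivariantHom ρ σ` — the `G`-equivariant `k`-linear maps `V → W` as a `k`-subspace;
* `orbitLinear ρ v hv : k[G ⧸ K] →ₗ[k] V` — the `G`-map `gK ↦ ρ g v` attached to a `K`-fixed
  vector `v`, built on Mathlib's permutation representation `Representation.ofMulAction k G (G ⧸ K)`;
* `frobeniusEquiv ρ : equivariantHom (ofMulAction k G (G ⧸ K)) ρ ≃ₗ[k] invariants ρ K` —
  FROBENIUS RECIPROCITY `Hom_G(k[G ⧸ K], V) ≅ V^K`, `f ↦ f(δ_K)`;
* `heckeAlgebra k K := Subalgebra.centralizer k (Set.range (ofMulAction k G (G ⧸ K)))` — the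
  Hecke algebra `H(G, K) = End_G(k[G ⧸ K])`, with `heckeAlgebraEquivInvariants`:
  `H(G, K) ≅ k[G ⧸ K]^K` as `k`-spaces (the functions on `K∖G/K`);
* `heckeSMul T v := f_v (T δ_K)` and `heckeAction ρ : (heckeAlgebra k K)ᵐᵒᵖ →ₐ[k] Module.End k V^K`
  — `V^K` is a module over `H(G, K)` (a right module: the action is by precomposition through
  Frobenius reciprocity, hence an algebra map out of the opposite algebra), natural in `V`
  (`invariantsMap_heckeSMul`).

In the record: `K` a compact open subgroup of a td-group, `V = π` smooth; the dictionary sentence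
«`π^K = Hom_G(ind_K^G 1, π)` is an `H(G, K)`-module, `H(G, K) = End_G(ind_K^G 1)`» is closed in
kernel form.  What stays prose: the identification of `End_G(k[G ⧸ K])` with the convolution
algebra of bi-`K`-invariant compactly supported functions (the Haar normalisation) and the
anti-isomorphism `f ↦ f^∨` between the left and the right conventions.

README §8(d): uses an L-value-free non-vanishing device: NO.
-/

namespace Summit.Ventures.HodgeRepro2.T5HeckePermutationModule

noncomputable section

open Summit.Ventures.HodgeRepro2.LevelPositivity
open MonoidAlgebra Representation

variable {G : Type*} [Group G] {k : Type*} [Field k] {V : Type*} [AddCommGroup V] [Module k V]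
  {W : Type*} [AddCommGroup W] [Module k W]

section Equivariant

variable (ρ : Representation k G V) (σ : Representation k G W)

/-- The `G`-equivariant `k`-linear maps `V → W` as a `k`-subspace of `V →ₗ[k] W`. -/
def equivariantHom : Submodule k (V →ₗ[k] W) where
  carrier := {f | ∀ g v, f (ρ g v) = σ g (f v)}
  add_mem' hf hf' g v := by simp [hf g v, hf' g v]
  zero_mem' g v := by simp
  smul_mem' c f hf g v := by simp [hf g v]

/-- Membership in `equivariantHom`. -/
theorem mem_equivariantHom_iff {f : V →ₗ[k] W} :
    f ∈ equivariantHom ρ σ ↔ ∀ g v, f (ρ g v) = σ g (f v) := Iff.rfl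

end Equivariant

section Permutation

variable (ρ : Representation k G V) {K : Subgroup G}

/-- The image of the basis vector `δ_K` under a `G`-map `k[G ⧸ K] → V` is `K`-fixed. -/
theorem apply_single_one_mem_invariants {f : MonoidAlgebra k (G ⧸ K) →ₗ[k] V}
    (hf : f ∈ equivariantHom (ofMulAction k G (G ⧸ K)) ρ) :
    f (single ((1 : G) : G ⧸ K) 1) ∈ invariants ρ K := by
  rw [mem_invariants_iff]
  intro g hg
  have h1 : ((g : G) : G ⧸ K) = ((1 : G) : G ⧸ K) := QuotientGroup.eq.2 (by simpa using inv_mem hg)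
  rw [← hf g, ofMulAction_single, MulAction.Quotient.smul_coe, smul_eq_mul, mul_one, h1]

/-- The orbit map `G ⧸ K → V`, `gK ↦ ρ g v`, of a `K`-fixed vector `v`. -/
def orbitMap (v : V) (hv : v ∈ invariants ρ K) : G ⧸ K → V :=
  Quotient.lift (fun g : G => ρ g v) (fun a b hab => by
    have hab' : a⁻¹ * b ∈ K := QuotientGroup.leftRel_apply.mp hab
    have : ρ b v = ρ a (ρ (a⁻¹ * b) v) := by
      rw [← Module.End.mul_apply, ← map_mul, mul_inv_cancel_left]
    rw [this, mem_invariants_iff.mp hv _ hab'])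

/-- `orbitMap` on the coset of `g`. -/
@[simp] theorem orbitMap_mk (v : V) (hv : v ∈ invariants ρ K) (g : G) :
    orbitMap ρ v hv (g : G ⧸ K) = ρ g v := rfl

/-- The orbit map is `G`-equivariant. -/
theorem orbitMap_smul (v : V) (hv : v ∈ invariants ρ K) (g : G) (x : G ⧸ K) :
    orbitMap ρ v hv (g • x) = ρ g (orbitMap ρ v hv x) := by
  induction x using QuotientGroup.induction_on with
  | H a => rw [MulAction.Quotient.smul_coe, smul_eq_mul, orbitMap_mk, orbitMap_mk, map_mul,
      Module.End.mul_apply]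

/-- The `k`-linear map `k[G ⧸ K] → V` extending the orbit map of a `K`-fixed vector. -/
def orbitLinear (v : V) (hv : v ∈ invariants ρ K) : MonoidAlgebra k (G ⧸ K) →ₗ[k] V :=
  Finsupp.linearCombination k (orbitMap ρ v hv) ∘ₗ (coeffLinearEquiv k).toLinearMap

/-- `orbitLinear` on a basis vector. -/
@[simp] theorem orbitLinear_single (v : V) (hv : v ∈ invariants ρ K) (x : G ⧸ K) (c : k) :
    orbitLinear ρ v hv (single x c) = c • orbitMap ρ v hv x := by
  simp [orbitLinear, coeff_single]

/-- `orbitLinear` sends `δ_K` back to `v`. -/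
@[simp] theorem orbitLinear_single_one (v : V) (hv : v ∈ invariants ρ K) :
    orbitLinear ρ v hv (single ((1 : G) : G ⧸ K) 1) = v := by
  simp

/-- `orbitMap` is additive in the vector. -/
theorem orbitMap_add (v v' : V) (hv : v ∈ invariants ρ K) (hv' : v' ∈ invariants ρ K)
    (h : v + v' ∈ invariants ρ K) (x : G ⧸ K) :
    orbitMap ρ (v + v') h x = orbitMap ρ v hv x + orbitMap ρ v' hv' x := by
  induction x using QuotientGroup.induction_on with
  | H a => simp

/-- `orbitMap` is `k`-linear in the vector. -/
theorem orbitMap_smul_vec (c : k) (v : V) (hv : v ∈ invariants ρ K) (h : c • v ∈ invariants ρ K)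
    (x : G ⧸ K) : orbitMap ρ (c • v) h x = c • orbitMap ρ v hv x := by
  induction x using QuotientGroup.induction_on with
  | H a => simp

/-- `orbitLinear` is additive in the vector. -/
theorem orbitLinear_add (v v' : V) (hv : v ∈ invariants ρ K) (hv' : v' ∈ invariants ρ K)
    (h : v + v' ∈ invariants ρ K) :
    orbitLinear ρ (v + v') h = orbitLinear ρ v hv + orbitLinear ρ v' hv' := by
  apply MonoidAlgebra.lhom_ext'
  intro x
  ext
  simp [orbitMap_add ρ v v' hv hv' h]

/-- `orbitLinear` of the zero vector. -/
theorem orbitLinear_zero (h : (0 : V) ∈ invariants ρ K) : orbitLinear ρ 0 h = 0 := by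
  apply MonoidAlgebra.lhom_ext'
  intro x
  ext
  induction x using QuotientGroup.induction_on with
  | H a => simp

/-- `orbitLinear` is `k`-linear in the vector. -/
theorem orbitLinear_smul (c : k) (v : V) (hv : v ∈ invariants ρ K) (h : c • v ∈ invariants ρ K) :
    orbitLinear ρ (c • v) h = c • orbitLinear ρ v hv := by
  apply MonoidAlgebra.lhom_ext'
  intro x
  ext
  simp [orbitMap_smul_vec ρ c v hv h]

/-- `orbitLinear` is `G`-equivariant. -/
theorem orbitLinear_mem_equivariantHom (v : V) (hv : v ∈ invariants ρ K) :
    orbitLinear ρ v hv ∈ equivariantHom (ofMulAction k G (G ⧸ K)) ρ := by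
  intro g x
  induction x using MonoidAlgebra.induction_linear with
  | zero => simp
  | add x y hx hy => simp only [map_add, hx, hy]
  | single a b => simp [orbitMap_smul]

/-- UNIQUENESS in Frobenius reciprocity: a `G`-map `k[G ⧸ K] → V` is the `orbitLinear` of the image
of `δ_K`. -/
theorem orbitLinear_apply_single_one {f : MonoidAlgebra k (G ⧸ K) →ₗ[k] V}
    (hf : f ∈ equivariantHom (ofMulAction k G (G ⧸ K)) ρ) :
    orbitLinear ρ (f (single ((1 : G) : G ⧸ K) 1)) (apply_single_one_mem_invariants ρ hf) = f := by
  apply MonoidAlgebra.lhom_ext'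
  intro x
  induction x using QuotientGroup.induction_on with
  | H a =>
    ext
    simp only [LinearMap.coe_comp, Function.comp_apply, lsingle_apply, orbitLinear_single,
      orbitMap_mk, one_smul]
    rw [← hf a, ofMulAction_single, MulAction.Quotient.smul_coe, smul_eq_mul, mul_one]

/-- Two `G`-maps `k[G ⧸ K] → V` agreeing on `δ_K` agree. -/
theorem equivariantHom_ext {f f' : MonoidAlgebra k (G ⧸ K) →ₗ[k] V}
    (hf : f ∈ equivariantHom (ofMulAction k G (G ⧸ K)) ρ)
    (hf' : f' ∈ equivariantHom (ofMulAction k G (G ⧸ K)) ρ)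
    (h : f (single ((1 : G) : G ⧸ K) 1) = f' (single ((1 : G) : G ⧸ K) 1)) : f = f' := by
  rw [← orbitLinear_apply_single_one ρ hf, ← orbitLinear_apply_single_one ρ hf']
  congr 1

/-- FROBENIUS RECIPROCITY: `Hom_G(k[G ⧸ K], V) ≃ V^K`, `f ↦ f(δ_K)`, inverse `v ↦ orbitLinear v`. -/
def frobeniusEquiv : equivariantHom (ofMulAction k G (G ⧸ K)) ρ ≃ₗ[k] invariants ρ K where
  toFun f := ⟨f.1 (single ((1 : G) : G ⧸ K) 1), apply_single_one_mem_invariants ρ f.2⟩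
  map_add' f f' := by ext; simp
  map_smul' c f := by ext; simp
  invFun v := ⟨orbitLinear ρ v.1 v.2, orbitLinear_mem_equivariantHom ρ v.1 v.2⟩
  left_inv f := Subtype.ext (orbitLinear_apply_single_one ρ f.2)
  right_inv v := Subtype.ext (orbitLinear_single_one ρ v.1 v.2)

/-- `frobeniusEquiv` evaluates at `δ_K`. -/
@[simp] theorem frobeniusEquiv_apply (f : equivariantHom (ofMulAction k G (G ⧸ K)) ρ) :
    (frobeniusEquiv ρ f : V) = f.1 (single ((1 : G) : G ⧸ K) 1) := rfl

/-- The inverse of `frobeniusEquiv` is `orbitLinear`. -/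
@[simp] theorem frobeniusEquiv_symm_apply (v : invariants ρ K) :
    ((frobeniusEquiv ρ).symm v : MonoidAlgebra k (G ⧸ K) →ₗ[k] V) = orbitLinear ρ v.1 v.2 := rfl

end Permutation

section Hecke

variable (k) (K : Subgroup G)

/-- The Hecke algebra `H(G, K) = End_G(k[G ⧸ K])`: the centralizer, in `End_k k[G ⧸ K]`, of the
operators of the permutation representation `ofMulAction k G (G ⧸ K)`. -/
def heckeAlgebra : Subalgebra k (Module.End k (MonoidAlgebra k (G ⧸ K))) :=
  Subalgebra.centralizer k (Set.range (ofMulAction k G (G ⧸ K)))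

variable {k K}

/-- Membership in the Hecke algebra: commuting with every `ofMulAction g`. -/
theorem mem_heckeAlgebra_iff {T : Module.End k (MonoidAlgebra k (G ⧸ K))} :
    T ∈ heckeAlgebra k K ↔
      ∀ g : G, ofMulAction k G (G ⧸ K) g * T = T * ofMulAction k G (G ⧸ K) g := by
  simp [heckeAlgebra, Subalgebra.mem_centralizer_iff]

/-- The Hecke algebra is the space of `G`-equivariant endomorphisms of `k[G ⧸ K]`. -/
theorem mem_heckeAlgebra_iff_mem_equivariantHom {T : Module.End k (MonoidAlgebra k (G ⧸ K))} :
    T ∈ heckeAlgebra k K ↔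
      T ∈ equivariantHom (ofMulAction k G (G ⧸ K)) (ofMulAction k G (G ⧸ K)) := by
  rw [mem_heckeAlgebra_iff, mem_equivariantHom_iff]
  constructor
  · intro h g x
    exact (LinearMap.congr_fun (h g) x).symm
  · intro h g
    exact LinearMap.ext fun x => (h g x).symm

/-- An element of the Hecke algebra commutes with the permutation action, pointwise. -/
theorem heckeAlgebra_apply_ofMulAction (T : heckeAlgebra k K) (g : G) (x : MonoidAlgebra k (G ⧸ K)) :
    T.1 (ofMulAction k G (G ⧸ K) g x) = ofMulAction k G (G ⧸ K) g (T.1 x) :=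
  mem_heckeAlgebra_iff_mem_equivariantHom.mp T.2 g x

/-- `H(G, K) ≅ k[G ⧸ K]^K` as `k`-spaces (Frobenius reciprocity for `V = k[G ⧸ K]`): the Hecke
algebra is the space of `K`-fixed vectors of the permutation module — the functions on `K∖G/K`. -/
def heckeAlgebraEquivInvariants :
    heckeAlgebra k K ≃ₗ[k] invariants (ofMulAction k G (G ⧸ K)) K where
  toFun T := ⟨T.1 (single ((1 : G) : G ⧸ K) 1),
    apply_single_one_mem_invariants _ (mem_heckeAlgebra_iff_mem_equivariantHom.mp T.2)⟩
  map_add' T T' := by ext; simp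
  map_smul' c T := by ext; simp
  invFun w := ⟨orbitLinear _ w.1 w.2,
    mem_heckeAlgebra_iff_mem_equivariantHom.mpr (orbitLinear_mem_equivariantHom _ w.1 w.2)⟩
  left_inv T := Subtype.ext
    (orbitLinear_apply_single_one _ (mem_heckeAlgebra_iff_mem_equivariantHom.mp T.2))
  right_inv w := Subtype.ext (orbitLinear_single_one _ w.1 w.2)

/-- `heckeAlgebraEquivInvariants` evaluates at `δ_K`. -/
@[simp] theorem heckeAlgebraEquivInvariants_apply (T : heckeAlgebra k K) :
    (heckeAlgebraEquivInvariants T : MonoidAlgebra k (G ⧸ K)) = T.1 (single ((1 : G) : G ⧸ K) 1) :=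
  rfl

end Hecke

section Action

variable (ρ : Representation k G V) {K : Subgroup G}

/-- The action of `T ∈ H(G, K)` on `v ∈ V^K`: `T • v = f_v (T δ_K)`, where `f_v = orbitLinear v`
is the `G`-map `k[G ⧸ K] → V` with `f_v (δ_K) = v`. -/
def heckeSMul (T : heckeAlgebra k K) (v : invariants ρ K) : invariants ρ K :=
  ⟨orbitLinear ρ v.1 v.2 (T.1 (single ((1 : G) : G ⧸ K) 1)), by
    rw [mem_invariants_iff]
    intro g hg
    have h1 : ((g : G) : G ⧸ K) = ((1 : G) : G ⧸ K) := QuotientGroup.eq.2 (by simpa using inv_mem hg)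
    rw [← orbitLinear_mem_equivariantHom ρ v.1 v.2 g, ← heckeAlgebra_apply_ofMulAction,
      ofMulAction_single, MulAction.Quotient.smul_coe, smul_eq_mul, mul_one, h1]⟩

/-- The value of `heckeSMul`. -/
@[simp] theorem heckeSMul_coe (T : heckeAlgebra k K) (v : invariants ρ K) :
    (heckeSMul ρ T v : V) = orbitLinear ρ v.1 v.2 (T.1 (single ((1 : G) : G ⧸ K) 1)) := rfl

/-- `heckeSMul` is the precomposition `f_v ↦ f_v ∘ T` read through Frobenius reciprocity. -/
theorem orbitLinear_heckeSMul (T : heckeAlgebra k K) (v : invariants ρ K) :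
    orbitLinear ρ (heckeSMul ρ T v).1 (heckeSMul ρ T v).2 = orbitLinear ρ v.1 v.2 ∘ₗ T.1 := by
  have hmem : orbitLinear ρ v.1 v.2 ∘ₗ T.1 ∈ equivariantHom (ofMulAction k G (G ⧸ K)) ρ := by
    intro g x
    simp only [LinearMap.coe_comp, Function.comp_apply]
    rw [heckeAlgebra_apply_ofMulAction, orbitLinear_mem_equivariantHom ρ v.1 v.2 g]
  exact equivariantHom_ext ρ (orbitLinear_mem_equivariantHom ρ _ _) hmem (by simp)

/-- The unit of `H(G, K)` acts as the identity. -/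
@[simp] theorem heckeSMul_one (v : invariants ρ K) : heckeSMul ρ 1 v = v := by
  ext; simp

/-- The action is contravariant in `T`: `(T * T') • v = T' • (T • v)` (a right action). -/
theorem heckeSMul_mul (T T' : heckeAlgebra k K) (v : invariants ρ K) :
    heckeSMul ρ (T * T') v = heckeSMul ρ T' (heckeSMul ρ T v) := by
  ext
  show orbitLinear ρ v.1 v.2 ((T * T').1 (single ((1 : G) : G ⧸ K) 1)) =
    orbitLinear ρ (heckeSMul ρ T v).1 (heckeSMul ρ T v).2 (T'.1 (single ((1 : G) : G ⧸ K) 1))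
  rw [orbitLinear_heckeSMul]
  rfl

/-- The action is additive in `T`. -/
theorem heckeSMul_add_left (T T' : heckeAlgebra k K) (v : invariants ρ K) :
    heckeSMul ρ (T + T') v = heckeSMul ρ T v + heckeSMul ρ T' v := by
  ext; simp

/-- The action of `0 ∈ H(G, K)`. -/
@[simp] theorem heckeSMul_zero_left (v : invariants ρ K) : heckeSMul ρ 0 v = 0 := by
  ext; simp

/-- The action is `k`-linear in `T`. -/
theorem heckeSMul_smul_left (c : k) (T : heckeAlgebra k K) (v : invariants ρ K) :
    heckeSMul ρ (c • T) v = c • heckeSMul ρ T v := by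
  ext; simp

/-- The action is additive in `v`. -/
theorem heckeSMul_add_right (T : heckeAlgebra k K) (v v' : invariants ρ K) :
    heckeSMul ρ T (v + v') = heckeSMul ρ T v + heckeSMul ρ T v' := by
  ext
  simp only [heckeSMul_coe, Submodule.coe_add]
  rw [orbitLinear_add ρ v.1 v'.1 v.2 v'.2 (v + v').2, LinearMap.add_apply]

/-- The action of `T` on `0 ∈ V^K`. -/
@[simp] theorem heckeSMul_zero_right (T : heckeAlgebra k K) : heckeSMul ρ T 0 = 0 := by
  ext
  simp only [heckeSMul_coe, Submodule.coe_zero]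
  rw [orbitLinear_zero ρ (0 : invariants ρ K).2, LinearMap.zero_apply]

/-- The action is `k`-linear in `v`. -/
theorem heckeSMul_smul_right (T : heckeAlgebra k K) (c : k) (v : invariants ρ K) :
    heckeSMul ρ T (c • v) = c • heckeSMul ρ T v := by
  ext
  simp only [heckeSMul_coe, Submodule.coe_smul]
  rw [orbitLinear_smul ρ c v.1 v.2 (c • v).2, LinearMap.smul_apply]

/-- The action of `T ∈ H(G, K)` on `V^K` as a `k`-linear endomorphism. -/
def heckeEnd (T : heckeAlgebra k K) : invariants ρ K →ₗ[k] invariants ρ K where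
  toFun := heckeSMul ρ T
  map_add' := heckeSMul_add_right ρ T
  map_smul' := heckeSMul_smul_right ρ T

/-- `heckeEnd` applies `heckeSMul`. -/
@[simp] theorem heckeEnd_apply (T : heckeAlgebra k K) (v : invariants ρ K) :
    heckeEnd ρ T v = heckeSMul ρ T v := rfl

/-- `V^K` IS A MODULE OVER THE HECKE ALGEBRA: the action `T ↦ (v ↦ T • v)` is a `k`-algebra
homomorphism from the opposite algebra `H(G, K)ᵐᵒᵖ` (the action is by precomposition through
Frobenius reciprocity, hence a right action) into `End_k (V^K)`. -/
def heckeAction : (heckeAlgebra k K)ᵐᵒᵖ →ₐ[k] Module.End k (invariants ρ K) where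
  toFun T := heckeEnd ρ T.unop
  map_one' := by ext; simp
  map_mul' T T' := by
    ext v
    simp [heckeSMul_mul]
  map_zero' := by ext; simp
  map_add' T T' := by
    ext v
    simp [heckeSMul_add_left]
  commutes' c := by
    ext v
    simp [Algebra.algebraMap_eq_smul_one, heckeSMul_smul_left]

/-- `heckeAction` applies `heckeSMul`. -/
@[simp] theorem heckeAction_apply (T : (heckeAlgebra k K)ᵐᵒᵖ) (v : invariants ρ K) :
    heckeAction ρ T v = heckeSMul ρ T.unop v := rfl

/-- The Hecke module structure on `V^K` (right module over `H(G, K)`, packaged as a left module over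
the opposite algebra). -/
@[reducible] def heckeModule : Module (heckeAlgebra k K)ᵐᵒᵖ (invariants ρ K) :=
  Module.compHom (invariants ρ K) (heckeAction ρ).toRingHom

/-- NATURALITY: a `G`-map `φ : V → W` induces an `H(G, K)`-linear map `V^K → W^K`
(`T5LevelIdempotentNaturality.invariantsMap`). -/
theorem invariantsMap_heckeSMul {σ : Representation k G W} (φ : V →ₗ[k] W)
    (hφ : ∀ g v, φ (ρ g v) = σ g (φ v)) (T : heckeAlgebra k K) (v : invariants ρ K) :
    T5LevelIdempotentNaturality.invariantsMap φ hφ K (heckeSMul ρ T v) =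
      heckeSMul σ T (T5LevelIdempotentNaturality.invariantsMap φ hφ K v) := by
  ext
  simp only [T5LevelIdempotentNaturality.invariantsMap_apply, heckeSMul_coe]
  have hmem : φ ∘ₗ orbitLinear ρ v.1 v.2 ∈ equivariantHom (ofMulAction k G (G ⧸ K)) σ := by
    intro g x
    simp only [LinearMap.coe_comp, Function.comp_apply]
    rw [orbitLinear_mem_equivariantHom ρ v.1 v.2 g, hφ]
  have h := equivariantHom_ext σ hmem
    (orbitLinear_mem_equivariantHom σ (φ v.1)
      ((T5LevelIdempotentNaturality.invariantsMap φ hφ K v).2)) (by simp)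
  exact LinearMap.congr_fun h _

end Action

end

end Summit.Ventures.HodgeRepro2.T5HeckePermutationModule
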